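import Literature.MathematicalPhysics.QuantumFieldTheory.Balaban1983to89.B9Eq349ConjugatedProjectionChainTower

/-!
# `Balaban1983to89.B9Eq325ProjectionDivergenceQuarterKappaTower` — T. Bałaban, *Propagators for lattice gauge theories in a background field*, Commun.
# Math. Phys. **99** (1985) 389–434 [Balaban1985BackgroundPropagators] (3.21)∕(3.25) p. 394 (with (3.16)∕(3.24) pp. 393–394), (3.49) p. 399, Thm 3.11 p. 416:
# **THE SHARP COMPLEMENTARY-PROJECTION LETTER AT THE TOWER — `‖D_U((1 − R_k(U))s)‖² ≤ (C_Q∕√κ₁)·‖s‖²` and `‖(1 − R_k(U))(D*_Uu)‖² ≤ (C_Q∕√κ₁)·‖u‖²` AT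
# EVERY HEIGHT `n`**, NO `C_E`, NO `‖c‖` — the tower twin of `B9Eq325ProjectionDivergenceQuarterKappa` (t4-ne9-idea-1 g141's N42 argument — CREDIT) over
# this lineage's `B9Eq349ConjugatedProjectionChainTower` §1 (`one_sub_RofUk_apply_eq`, `inner_one_sub_RofUk_left`, `sq_mul_norm_sq_le_norm_GQk_sq`,
# `sq_norm_covDerivL2K_le_re_inner_k`); the letter `C_P` of `B9Eq326ConjugatedDeltaATower` (`hP`) with `C_P = √(C_Q∕√κ₁)`

statement-level skeleton of published theorems with citation tags; proofs where landed; nothing here is a claim about the Yang–Mills mass gap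

CITATION HEADER (lean-in-tree rule).  Audit cell `pub-balaban`, sub-cell `t4`, BINDER row NE9; filed by NE9 formalisation-swarm leaf prover 03
(`b2b-balaban-t4-ne9-formalise-leaf-03`, gen 75).  Imports this lineage's `B9Eq349ConjugatedProjectionChainTower` (gen 74) only.  Sources READ first-hand:
[Balaban1985BackgroundPropagators] p. 394 (3.21)∕(3.25), pp. 393–394 (3.16)∕(3.24), p. 399 (3.49), p. 416 Thm 3.11.  [folklore] energy bookkeeping; nothing of
print's asserted.

WHAT IS PROVED (sorry-free; proof lane — no `def`).  Letters: `hQ : ‖Q̃′_ks‖ ≤ C_Q‖s‖`, `hκ : κ₁‖ψ‖² ≤ re⟪ψ, Q̃′_kG′_k²Q̃′_k†ψ⟫` (KAPPA1 at `k` levels), `a′ ≥ 0`,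
`hRS`, `hpos′`.
* `norm_one_sub_RofUk_le`, **`sq_norm_covDerivL2K_one_sub_RofUk_le`**, **`sq_norm_one_sub_RofUk_covDivL2K_le`**, `norm_one_sub_RofUk_covDivL2K_le_sqrt`.
HONEST SCOPE.  `C_Q`, `κ₁` displayed per height; nothing of [B9] Thm 3.1∕3.3∕3.11 or (3.49) asserted or valued; «NE9 ⇐ the named binders»; NE9 NOT PRINTED ∕
NOT PROVED; row WALLED ON A MODEL (O-NE9-1; #5 UNRULED); spine PROVED 0∕9; rung (B)+1 on a finite T⁴ — NOT infinite volume, NOT mass gap, NOT BetaPertH, NOT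
Clay.  HONEST DEPENDENCY: continuum YM on T⁴ ⇐ BetaPertH ∧ nine spine estimates (0/9 proved); BetaPertH ⇐ (D1) ∧ (D4) ∧ CAP+tail.  NEW file; nothing
modified.  Net new unproved facts: 0.
-/

noncomputable section

open scoped InnerProductSpace ComplexConjugate

namespace Literature.MathematicalPhysics.QuantumFieldTheory.Balaban1983to89.B9Eq325ProjectionDivergenceQuarterKappaTower

open B4Sect5Torus (TSite)
open B9SectCLatticeCarrier (Bond)
open B9Eq311L2Pairing (WL2)
open B9Eq315QTower (towerP)
open B11Eq103H1Complex (SiteL2K BondL2K greenK apply_greenK covDerivL2K covDivL2K adjoint_covDerivL2K)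
open B9Eq310HessianOperator (adTransportW)
open B9Eq326OperatorTower (QprimeTowerW RofUk RofUk_isSymmetric)
open B9Eq324DeltaPrimeATower (laplacePrimeAk GpOfUk)
open B9Eq325ProjFormulaTower (QGGQk_pos)
open B9Eq349ConjugatedProjectionChainTower (one_sub_RofUk_apply_eq inner_one_sub_RofUk_left sq_mul_norm_sq_le_norm_GQk_sq sq_norm_covDerivL2K_le_re_inner_k)

variable {d : ℕ} (L : ℕ) [NeZero L] (m : Fin d → ℕ) [∀ i, NeZero (m i)] (n : ℕ)
  {𝔸 : Type*} [NormedRing 𝔸] [NormedAlgebra ℂ 𝔸] [CompleteSpace 𝔸]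
  {W : Type*} [NormedAddCommGroup W] [InnerProductSpace ℂ W] [FiniteDimensional ℂ W] (φ : W ≃ₗ[ℂ] 𝔸) (c₀ : ℝ) [Fact (0 < c₀)]
  (η : ℝ) (U : Bond d (towerP L m (n + 1)) → 𝔸ˣ) (c₁ : ℝ) [Fact (0 < c₁)] (a' : ℝ)
  (hRS : ∀ (b : Bond d (towerP L m (n + 1))) (v u : W), ⟪adTransportW φ U b v, u⟫_ℂ = ⟪v, adTransportW φ (fun b => (U b)⁻¹) b u⟫_ℂ)
  (hpos' : ∀ x : SiteL2K ℂ d (towerP L m (n + 1)) c₀ W, x ≠ 0 → 0 < RCLike.re ⟪x, laplacePrimeAk L m n φ η U a' (c₁ := c₁) x⟫_ℂ)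

/-- `conj η⁻¹ = η⁻¹`. [folklore] [cite: Balaban1985BackgroundPropagators, (3.3) p.391] -/
private theorem conj_inv_eta' : (starRingEnd ℂ) ((η : ℂ))⁻¹ = ((η : ℂ))⁻¹ := by rw [map_inv₀, Complex.conj_ofReal]

omit [Fact (0 < c₁)] in
/-- **`‖s − R(U)s‖ ≤ ‖s‖`** — `1 − R(U)` is a symmetric idempotent (`inner_one_sub_RofU_left` + `B11Eq103H1Complex.projR_projR`).
[cite: Balaban1985BackgroundPropagators, (3.21) p.394] -/
theorem norm_one_sub_RofUk_le (s : SiteL2K ℂ d (towerP L m (n + 1)) c₀ W) : ‖s - RofUk L m n φ η U (c₀ := c₀) s‖ ≤ ‖s‖ := by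
  have hRR : RofUk L m n φ η U (c₀ := c₀) (RofUk L m n φ η U (c₀ := c₀) s) = RofUk L m n φ η U (c₀ := c₀) s := by
    unfold RofUk B11Eq103H1Complex.RLatticeK; exact B11Eq103H1Complex.projR_projR _ _ s
  have key : ⟪s - RofUk L m n φ η U (c₀ := c₀) s, s - RofUk L m n φ η U (c₀ := c₀) s⟫_ℂ = ⟪s - RofUk L m n φ η U (c₀ := c₀) s, s⟫_ℂ := by
    have h := inner_one_sub_RofUk_left L m n φ c₀ η U (s - RofUk L m n φ η U (c₀ := c₀) s) s
    rw [map_sub, hRR, sub_self, sub_zero] at h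
    exact h.symm
  have h1 : ‖s - RofUk L m n φ η U (c₀ := c₀) s‖ ^ 2 = RCLike.re ⟪s - RofUk L m n φ η U (c₀ := c₀) s, s⟫_ℂ := by
    rw [← inner_self_eq_norm_sq (𝕜 := ℂ), key]
  have h2 : RCLike.re ⟪s - RofUk L m n φ η U (c₀ := c₀) s, s⟫_ℂ ≤ ‖s - RofUk L m n φ η U (c₀ := c₀) s‖ * ‖s‖ :=
    (RCLike.re_le_norm _).trans (norm_inner_le_norm _ _)
  by_cases hx : s - RofUk L m n φ η U (c₀ := c₀) s = 0
  · rw [hx, norm_zero]; exact norm_nonneg _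
  · have hxpos : 0 < ‖s - RofUk L m n φ η U (c₀ := c₀) s‖ := norm_pos_iff.mpr hx
    nlinarith [h1, h2, hxpos]

include hRS in
/-- **`‖D_U(s − R(U)s)‖² ≤ (C_Q∕√κ₁)·‖s‖²`** (t4-ne9-idea-1 g141, N42): with `ψ = c(Q̃′(G′s))`, `s − R(U)s = G′(Q̃′†ψ)`; energy at `f = G′(Q̃′†ψ)`:
`‖D_U(s − Rs)‖² ≤ re⟪s − Rs, Q̃′†ψ⟫ = re⟪Q̃′(s − Rs), ψ⟫ ≤ C_Q‖s‖‖ψ‖`; KAPPA1: `κ₁‖ψ‖² ≤ ‖G′(Q̃′†ψ)‖² = ‖s − Rs‖² ≤ ‖s‖²`, so `‖ψ‖ ≤ ‖s‖∕√κ₁`. [folklore]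
[cite: Balaban1985BackgroundPropagators, (3.21) p.394, (3.25) p.394, (3.49) p.399, Thm 3.11 p.416] -/
theorem sq_norm_covDerivL2K_one_sub_RofUk_le (ha' : 0 ≤ a') {CQ κ₁ : ℝ} (hCQ : 0 ≤ CQ) (hκ₁ : 0 < κ₁)
    (hQ : ∀ s, ‖((WL2.linearEquiv ℂ ℂ (fun _ : TSite d m => c₁)).symm.toLinearMap ∘ₗ QprimeTowerW L m n φ U (c₀ := c₀)) s‖ ≤ CQ * ‖s‖)
    (hκ : ∀ ψ : SiteL2K ℂ d m c₁ W, κ₁ * ‖ψ‖ ^ 2 ≤ RCLike.re ⟪ψ,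
      (((WL2.linearEquiv ℂ ℂ (fun _ : TSite d m => c₁)).symm.toLinearMap ∘ₗ QprimeTowerW L m n φ U (c₀ := c₀)) ∘ₗ
        GpOfUk L m n φ η U a' (c₁ := c₁) hpos' ∘ₗ GpOfUk L m n φ η U a' (c₁ := c₁) hpos' ∘ₗ
        LinearMap.adjoint ((WL2.linearEquiv ℂ ℂ (fun _ : TSite d m => c₁)).symm.toLinearMap ∘ₗ QprimeTowerW L m n φ U (c₀ := c₀))) ψ⟫_ℂ)
    (s : SiteL2K ℂ d (towerP L m (n + 1)) c₀ W) :
    ‖covDerivL2K ℂ c₀ ((η : ℂ))⁻¹ (adTransportW φ U) (s - RofUk L m n φ η U (c₀ := c₀) s)‖ ^ 2 ≤ CQ / Real.sqrt κ₁ * ‖s‖ ^ 2 := by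
  set Qt := (WL2.linearEquiv ℂ ℂ (fun _ : TSite d m => c₁)).symm.toLinearMap ∘ₗ QprimeTowerW L m n φ U (c₀ := c₀) with hQt
  set Gp := GpOfUk L m n φ η U a' (c₁ := c₁) hpos' with hGp
  set ψ := greenK _ (QGGQk_pos L m n φ c₀ η U c₁ a' hRS hpos') (Qt (Gp s)) with hψ
  have hP : s - RofUk L m n φ η U (c₀ := c₀) s = Gp (LinearMap.adjoint Qt ψ) := by
    rw [one_sub_RofUk_apply_eq L m n φ c₀ η U c₁ a' hRS hpos' s]; rfl
  -- energy
  have hEn : ‖covDerivL2K ℂ c₀ ((η : ℂ))⁻¹ (adTransportW φ U) (s - RofUk L m n φ η U (c₀ := c₀) s)‖ ^ 2 ≤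
      RCLike.re ⟪s - RofUk L m n φ η U (c₀ := c₀) s, LinearMap.adjoint Qt ψ⟫_ℂ := by
    have h := sq_norm_covDerivL2K_le_re_inner_k L m n φ c₀ η U c₁ a' hRS ha' (s - RofUk L m n φ η U (c₀ := c₀) s)
    have hGΔ : ∀ v, laplacePrimeAk L m n φ η U a' (c₁ := c₁) (Gp v) = v := fun v => apply_greenK hpos' v
    refine h.trans (le_of_eq ?_)
    conv_lhs => rw [hP]
    rw [hGΔ, ← hP]
  have hEn' : RCLike.re ⟪s - RofUk L m n φ η U (c₀ := c₀) s, LinearMap.adjoint Qt ψ⟫_ℂ ≤ CQ * ‖s‖ * ‖ψ‖ := by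
    rw [LinearMap.adjoint_inner_right]
    refine ((RCLike.re_le_norm _).trans (norm_inner_le_norm _ _)).trans ?_
    exact mul_le_mul_of_nonneg_right ((hQ _).trans (mul_le_mul_of_nonneg_left (norm_one_sub_RofUk_le L m n φ c₀ η U s) hCQ)) (norm_nonneg _)
  -- KAPPA1 at ψ
  have hk := sq_mul_norm_sq_le_norm_GQk_sq L m n φ c₀ η U c₁ a' hRS hpos' hκ ψ
  have hk' : κ₁ * ‖ψ‖ ^ 2 ≤ ‖s‖ ^ 2 := by
    refine hk.trans ?_
    have : (Gp ∘ₗ LinearMap.adjoint Qt) ψ = s - RofUk L m n φ η U (c₀ := c₀) s := by rw [LinearMap.comp_apply, ← hP]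
    rw [← hGp, ← hQt, this]
    exact pow_le_pow_left₀ (norm_nonneg _) (norm_one_sub_RofUk_le L m n φ c₀ η U s) 2
  have hψle : ‖ψ‖ ≤ ‖s‖ / Real.sqrt κ₁ := by
    rw [le_div_iff₀ (Real.sqrt_pos.2 hκ₁)]
    have h3 : (‖ψ‖ * Real.sqrt κ₁) ^ 2 ≤ ‖s‖ ^ 2 := by rw [mul_pow, Real.sq_sqrt hκ₁.le]; linarith
    nlinarith [h3, norm_nonneg s, norm_nonneg ψ, Real.sqrt_nonneg κ₁, mul_nonneg (norm_nonneg ψ) (Real.sqrt_nonneg κ₁)]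
  calc ‖covDerivL2K ℂ c₀ ((η : ℂ))⁻¹ (adTransportW φ U) (s - RofUk L m n φ η U (c₀ := c₀) s)‖ ^ 2 ≤ CQ * ‖s‖ * ‖ψ‖ := hEn.trans hEn'
    _ ≤ CQ * ‖s‖ * (‖s‖ / Real.sqrt κ₁) := mul_le_mul_of_nonneg_left hψle (by positivity)
    _ = CQ / Real.sqrt κ₁ * ‖s‖ ^ 2 := by ring

include hRS in
/-- **`‖D*_Uu − R(U)(D*_Uu)‖² ≤ (C_Q∕√κ₁)·‖u‖²`** — the adjoint pair: `‖(1 − R)D*_Uu‖² = re⟪u, D_U((1 − R)((1 − R)D*_Uu))⟫ ≤ ‖u‖·√(C_Q∕√κ₁)·‖(1 − R)D*_Uu‖`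
(`1 − R` symmetric idempotent, `D*_U = D_U†`). [folklore] [cite: Balaban1985BackgroundPropagators, (3.8) p.392, (3.21) p.394, (3.25) p.394, Thm 3.11 p.416] -/
theorem sq_norm_one_sub_RofUk_covDivL2K_le (ha' : 0 ≤ a') {CQ κ₁ : ℝ} (hCQ : 0 ≤ CQ) (hκ₁ : 0 < κ₁)
    (hQ : ∀ s, ‖((WL2.linearEquiv ℂ ℂ (fun _ : TSite d m => c₁)).symm.toLinearMap ∘ₗ QprimeTowerW L m n φ U (c₀ := c₀)) s‖ ≤ CQ * ‖s‖)
    (hκ : ∀ ψ : SiteL2K ℂ d m c₁ W, κ₁ * ‖ψ‖ ^ 2 ≤ RCLike.re ⟪ψ,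
      (((WL2.linearEquiv ℂ ℂ (fun _ : TSite d m => c₁)).symm.toLinearMap ∘ₗ QprimeTowerW L m n φ U (c₀ := c₀)) ∘ₗ
        GpOfUk L m n φ η U a' (c₁ := c₁) hpos' ∘ₗ GpOfUk L m n φ η U a' (c₁ := c₁) hpos' ∘ₗ
        LinearMap.adjoint ((WL2.linearEquiv ℂ ℂ (fun _ : TSite d m => c₁)).symm.toLinearMap ∘ₗ QprimeTowerW L m n φ U (c₀ := c₀))) ψ⟫_ℂ)
    (u : BondL2K ℂ d (towerP L m (n + 1)) c₀ W) :
    ‖covDivL2K ℂ c₀ ((η : ℂ))⁻¹ (adTransportW φ fun b => (U b)⁻¹) u -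
        RofUk L m n φ η U (c₀ := c₀) (covDivL2K ℂ c₀ ((η : ℂ))⁻¹ (adTransportW φ fun b => (U b)⁻¹) u)‖ ^ 2 ≤ CQ / Real.sqrt κ₁ * ‖u‖ ^ 2 := by
  set w := covDivL2K ℂ c₀ ((η : ℂ))⁻¹ (adTransportW φ fun b => (U b)⁻¹) u -
    RofUk L m n φ η U (c₀ := c₀) (covDivL2K ℂ c₀ ((η : ℂ))⁻¹ (adTransportW φ fun b => (U b)⁻¹) u) with hw
  have hRR : RofUk L m n φ η U (c₀ := c₀) (RofUk L m n φ η U (c₀ := c₀) (covDivL2K ℂ c₀ ((η : ℂ))⁻¹ (adTransportW φ fun b => (U b)⁻¹) u)) =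
      RofUk L m n φ η U (c₀ := c₀) (covDivL2K ℂ c₀ ((η : ℂ))⁻¹ (adTransportW φ fun b => (U b)⁻¹) u) := by
    unfold RofUk B11Eq103H1Complex.RLatticeK; exact B11Eq103H1Complex.projR_projR _ _ _
  have hPP : w - RofUk L m n φ η U (c₀ := c₀) w = w := by
    rw [hw, map_sub, hRR, sub_self, sub_zero]
  have hadj : covDivL2K ℂ c₀ ((η : ℂ))⁻¹ (adTransportW φ fun b => (U b)⁻¹) =
      LinearMap.adjoint (covDerivL2K ℂ c₀ ((η : ℂ))⁻¹ (adTransportW φ U)) := (adjoint_covDerivL2K _ (conj_inv_eta' η) _ _ hRS).symm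
  -- ‖w‖² = re⟪w, D*u − R(D*u)⟫ = re⟪w − Rw, D*u⟫ = re⟪w, D*u⟫ = re⟪D w, u⟫
  have e : ‖w‖ ^ 2 = RCLike.re ⟪covDerivL2K ℂ c₀ ((η : ℂ))⁻¹ (adTransportW φ U) w, u⟫_ℂ := by
    rw [← inner_self_eq_norm_sq (𝕜 := ℂ)]
    conv_lhs => rw [hw]
    rw [← hw]
    conv_lhs => rw [show ⟪w, covDivL2K ℂ c₀ ((η : ℂ))⁻¹ (adTransportW φ fun b => (U b)⁻¹) u -
        RofUk L m n φ η U (c₀ := c₀) (covDivL2K ℂ c₀ ((η : ℂ))⁻¹ (adTransportW φ fun b => (U b)⁻¹) u)⟫_ℂ =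
        ⟪w - RofUk L m n φ η U (c₀ := c₀) w, covDivL2K ℂ c₀ ((η : ℂ))⁻¹ (adTransportW φ fun b => (U b)⁻¹) u⟫_ℂ from
      (inner_one_sub_RofUk_left L m n φ c₀ η U w _).symm, hPP, hadj, LinearMap.adjoint_inner_right]
  have h1 := sq_norm_covDerivL2K_one_sub_RofUk_le L m n φ c₀ η U c₁ a' hRS hpos' ha' hCQ hκ₁ hQ hκ w
  rw [hPP] at h1
  have h2 : RCLike.re ⟪covDerivL2K ℂ c₀ ((η : ℂ))⁻¹ (adTransportW φ U) w, u⟫_ℂ ≤ ‖covDerivL2K ℂ c₀ ((η : ℂ))⁻¹ (adTransportW φ U) w‖ * ‖u‖ :=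
    (RCLike.re_le_norm _).trans (norm_inner_le_norm _ _)
  have hC : 0 ≤ CQ / Real.sqrt κ₁ := by positivity
  -- ‖Dw‖ ≤ √(C)‖w‖, so ‖w‖² ≤ √C ‖w‖ ‖u‖, so ‖w‖ ≤ √C ‖u‖, so ‖w‖² ≤ C ‖u‖²
  have h3 : ‖covDerivL2K ℂ c₀ ((η : ℂ))⁻¹ (adTransportW φ U) w‖ ≤ Real.sqrt (CQ / Real.sqrt κ₁) * ‖w‖ := by
    have : ‖covDerivL2K ℂ c₀ ((η : ℂ))⁻¹ (adTransportW φ U) w‖ ^ 2 ≤ (Real.sqrt (CQ / Real.sqrt κ₁) * ‖w‖) ^ 2 := by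
      rw [mul_pow, Real.sq_sqrt hC]; exact h1
    nlinarith [this, norm_nonneg (covDerivL2K ℂ c₀ ((η : ℂ))⁻¹ (adTransportW φ U) w), mul_nonneg (Real.sqrt_nonneg (CQ / Real.sqrt κ₁)) (norm_nonneg w)]
  have h4 : ‖w‖ ≤ Real.sqrt (CQ / Real.sqrt κ₁) * ‖u‖ := by
    have h5 : ‖w‖ ^ 2 ≤ Real.sqrt (CQ / Real.sqrt κ₁) * ‖w‖ * ‖u‖ := by nlinarith [e, h2, h3, norm_nonneg u]
    by_cases hx : w = 0
    · rw [hx, norm_zero]; positivity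
    · have hxpos : 0 < ‖w‖ := norm_pos_iff.mpr hx
      nlinarith [h5, hxpos]
  calc ‖w‖ ^ 2 ≤ (Real.sqrt (CQ / Real.sqrt κ₁) * ‖u‖) ^ 2 := pow_le_pow_left₀ (norm_nonneg _) h4 2
    _ = CQ / Real.sqrt κ₁ * ‖u‖ ^ 2 := by rw [mul_pow, Real.sq_sqrt hC]

include hRS in
/-- **`‖D*_Uu − R(U)(D*_Uu)‖ ≤ √(C_Q∕√κ₁)·‖u‖`** — the letter `C_P` of `B9Eq326ConjugatedDeltaALetters` ∕ `B9Eq326ConjugatedDeltaA` in its sharp form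
`C_P = √(C_Q∕√κ₁)` (no `C_E`). [folklore] [cite: Balaban1985BackgroundPropagators, (3.21) p.394, (3.25) p.394, Thm 3.11 p.416] -/
theorem norm_one_sub_RofUk_covDivL2K_le_sqrt (ha' : 0 ≤ a') {CQ κ₁ : ℝ} (hCQ : 0 ≤ CQ) (hκ₁ : 0 < κ₁)
    (hQ : ∀ s, ‖((WL2.linearEquiv ℂ ℂ (fun _ : TSite d m => c₁)).symm.toLinearMap ∘ₗ QprimeTowerW L m n φ U (c₀ := c₀)) s‖ ≤ CQ * ‖s‖)
    (hκ : ∀ ψ : SiteL2K ℂ d m c₁ W, κ₁ * ‖ψ‖ ^ 2 ≤ RCLike.re ⟪ψ,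
      (((WL2.linearEquiv ℂ ℂ (fun _ : TSite d m => c₁)).symm.toLinearMap ∘ₗ QprimeTowerW L m n φ U (c₀ := c₀)) ∘ₗ
        GpOfUk L m n φ η U a' (c₁ := c₁) hpos' ∘ₗ GpOfUk L m n φ η U a' (c₁ := c₁) hpos' ∘ₗ
        LinearMap.adjoint ((WL2.linearEquiv ℂ ℂ (fun _ : TSite d m => c₁)).symm.toLinearMap ∘ₗ QprimeTowerW L m n φ U (c₀ := c₀))) ψ⟫_ℂ)
    (u : BondL2K ℂ d (towerP L m (n + 1)) c₀ W) :
    ‖covDivL2K ℂ c₀ ((η : ℂ))⁻¹ (adTransportW φ fun b => (U b)⁻¹) u -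
        RofUk L m n φ η U (c₀ := c₀) (covDivL2K ℂ c₀ ((η : ℂ))⁻¹ (adTransportW φ fun b => (U b)⁻¹) u)‖ ≤ Real.sqrt (CQ / Real.sqrt κ₁) * ‖u‖ := by
  have h := sq_norm_one_sub_RofUk_covDivL2K_le L m n φ c₀ η U c₁ a' hRS hpos' ha' hCQ hκ₁ hQ hκ u
  have hC : 0 ≤ CQ / Real.sqrt κ₁ := by positivity
  have h' : ‖covDivL2K ℂ c₀ ((η : ℂ))⁻¹ (adTransportW φ fun b => (U b)⁻¹) u -
      RofUk L m n φ η U (c₀ := c₀) (covDivL2K ℂ c₀ ((η : ℂ))⁻¹ (adTransportW φ fun b => (U b)⁻¹) u)‖ ^ 2 ≤ (Real.sqrt (CQ / Real.sqrt κ₁) * ‖u‖) ^ 2 := by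
    rw [mul_pow, Real.sq_sqrt hC]; exact h
  nlinarith [h', norm_nonneg (covDivL2K ℂ c₀ ((η : ℂ))⁻¹ (adTransportW φ fun b => (U b)⁻¹) u -
      RofUk L m n φ η U (c₀ := c₀) (covDivL2K ℂ c₀ ((η : ℂ))⁻¹ (adTransportW φ fun b => (U b)⁻¹) u)),
    mul_nonneg (Real.sqrt_nonneg (CQ / Real.sqrt κ₁)) (norm_nonneg u)]

end Literature.MathematicalPhysics.QuantumFieldTheory.Balaban1983to89.B9Eq325ProjectionDivergenceQuarterKappaTower

end
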